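import Summits.BirchSwinnertonDyer.BirchSwinnertonDyer.Theorems.EisensteinPrimesBSDpOnCellCTelescopeK2SelmerTorsionDefect
import HarnessLib

/-!
# Crux 4 `BSDpOnCellC` (stmt-BirchSwinnertonDyer-19034), line `telescope`, leaf N2 `stub_weightTwoControl` (W2) / N3′: the
# REFINED torsion-defect control at an INERTIA-type index — the local obstruction of a global class at `I_w` is the `δ₀` of an
# invariant `w` whose class in `M^{I_w} ⧸ r·M^{I_w}` is FIXED BY THE DECOMPOSITION GROUP `D_w`, so the hypothesis `hkill` of
# `TelescopeK2SelmerTorsionDefect.smul_mem_map_torsionInclH1_selmer` (p743708) need only hold for `D_w`-invariant classes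
# (repair (R2) of memo `W2-BINDERS-x2p2g19.md` §3, Selmer side; helper, `--supports stmt-BirchSwinnertonDyer-19034 --as helper`; closes nothing)

Cell `bsd-eis`, width seat `bsd-line-x2-p2` (prover g19, 2026-08-29; D-0154 KEY row 5). THEOREMS ONLY: no definition, no named
fact, no `sorry`, no instance, no notation. Pure cocycle algebra in the tree's `continuousCohomology` / `TorsionControl` model.

WHY. At a ramified `w ∣ N` the `I_w`-defect `(M₂|_{I_w})^{I_w} ⧸ (C X)` of the big module is `C^∞(ℤ_p, A₂^{I_w}/X·A₂^{I_w})`, NOT killed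
by any scalar prime to `C X` when `A₂^{I_w}/X` is infinite (evidence #52 §3) — so p743708's `hkill` cannot be fed there. But the local
obstruction of a GLOBAL class restricted through `D_w ⊇ I_w` is `D_w`-invariant; on the `D_w`-fixed part (fixed points of the SHIFTED
Frobenius, `w` finitely decomposed in `K_∞`) a scalar prime to `C X` does act by zero (GV00 Prop. 2.4 machinery, tree
`BigRepModuleDualShiftedEndomorphism*`, `BigRepShiftedEndomorphismModelsProofs`; the annihilator step is NOT in this file).

## What is proved (any `Γ`, any discrete `A`-linear `ρ`, `r s : A`)

* §1 **`exists_invariant_δ₀_eq_of_factor`** — for `φI : I → Γ` factoring as `ψ ∘ ι` through `ι : I → D`, `ψ : D → Γ` with `ι(I)`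
  NORMAL in `D` (`∀ d h, ∃ h₀, ι h₀ = d⁻¹ ι(h) d`): if `x ∈ H¹(Γ, M[r])` has `H¹(ι_M)(res_{φI} x) = 0` in `H¹(I, M)`, then
  `res_{φI} x = δ₀(w)` for an invariant `w ∈ (M|_I)^I` with **`ρ(ψ d) w − w ∈ r • (M|_I)^I` for every `d ∈ D`**. Proof: a cocycle `c`
  of `x` on `Γ` with `c(ψ ι h) = (ψιh) m₂ − m₂` on `I`; `w := r • m₂`; for `d ∈ D` the element `u_d = (ψd) m₂ − m₂ − c(ψ d)` is `I`-fixed by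
  the cocycle identity at `d · ι h₀ = ι h · d`, and `(ψ d) w − w = r • u_d`.
* §2 **`smul_mem_map_torsionInclH1_selmer_of_factor`** — p743708's theorem with, at every index `v`, a factorization
  `φ v = ψ v ∘ ι v` (trivial factorization allowed) and the WEAKER hypothesis
  `hkill : ∀ v ∈ L, ∀ w ∈ (M|_v)^{Γ_v}, (∀ d, ρ(ψ v d) w − w ∈ r • (M|_v)^{Γ_v}) → ∃ w' ∈ (M|_v)^{Γ_v}, r • w' = s • w`;
  conclusion unchanged: `s • y ∈ H¹(ι)(Sel_L(M[r]))` for every `r`-torsion Selmer class `y` (`M` `r`-divisible).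
  For the K2 strict set: at `Sum.inr w` take `D = Γ_{K_w}`, `ι = inertiaIncl K w`, `ψ = localMap K (Sum.inl w)` (`localMap K (Sum.inr w) =
  ψ ∘ ι` by definition; `I_{K_w} ⊴ Γ_{K_w}`); at `Sum.inl 𝔭bar` the trivial factorization.

HONEST FRAMING: generic cohomological algebra; the annihilator of the `D_w`-fixed part (and hence W2 at ramified primes without the
inertia clause (inert)) is NOT proved here; nothing about any curve is asserted; BSD is proved for no pair; no registered stub, crux
or summit statement is proved by this file; closes: none.

References: [JetchevSkinnerWan2017] §3.4, Lemma 3.4.1 (arXiv:1512.06894 p. 14); [GreenbergVatsal2000] Prop. 2.4 (the local condition at a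
finitely decomposed prime through `D_ℓ/I_ℓ`); [Ochiai2006] Prop. 5.1 (Compositio 142 p. 1177: the local terms `((A^{I_v})_J)^{G_{ℚ_v}}` — the
`G_v`-INVARIANTS of the inertia term); [SerreGaloisCohomology1997] I §2.2, §5.8.
-/

noncomputable section

-- D-0017: single-problem summit, the namespace repeats the problem name by design.
set_option linter.dupNamespace false
set_option autoImplicit false

open CategoryTheory Literature.NumberTheory.GaloisRepresentations
open scoped ContRepresentation Pointwise

universe u

namespace Summit.BirchSwinnertonDyer.BirchSwinnertonDyer.Theorems.TelescopeK2RefinedLocalDefect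

open Summit.BirchSwinnertonDyer.Rank1Residual.X11b
open Summit.BirchSwinnertonDyer.Rank1Residual.X11b.TorsionControl

variable {A : Type*} [CommRing A] [TopologicalSpace A]
variable {Γ : Type u} [Group Γ] [TopologicalSpace Γ] [IsTopologicalGroup Γ]
variable {M : Type u} [AddCommGroup M] [Module A M] [TopologicalSpace M] [DiscreteTopology M]
  [ContinuousSMul A M]

/-! ## §1 The local obstruction at a normal subgroup is `δ₀` of a `D`-invariant class -/

section Local

variable {D I : Type u} [Group D] [TopologicalSpace D]
  [Group I] [TopologicalSpace I] [IsTopologicalGroup I]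
  (ρ : ContinuousRep Γ A M) (r : A) (φI : I →ₜ* Γ) (ψ : D →ₜ* Γ) (ι : I →ₜ* D)

/-- **The `I`-obstruction of a global class is `δ₀` of an invariant whose class mod `r` is `D`-fixed.** See the module docstring.
[cite: SerreGaloisCohomology1997, I §5.8 (restriction to a normal subgroup lands in the invariants)]
[cite: JetchevSkinnerWan2017, §3.4, Lemma 3.4.1 (arXiv:1512.06894 p. 14)] [folklore] -/
theorem exists_invariant_δ₀_eq_of_factor (hr : Function.Surjective fun m : M => r • m)
    (hfac : ∀ h : I, φI h = ψ (ι h)) (hnormal : ∀ (d : D) (h : I), ∃ h₀ : I, ι h₀ = d⁻¹ * ι h * d)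
    (x : continuousCohomology 1 (torsionRep ρ r).toTopRep)
    (hx : cohomologyMap (torsionIncl (ρ.restrict φI) r) 1 (resH1 (torsionRep ρ r) φI x) = 0) :
    ∃ w : ↥((ρ.restrict φI).toTopRep.ρ.invariants),
      (isSES_torsion (ρ.restrict φI) r hr).δ₀ w = resH1 (torsionRep ρ r) φI x ∧
      ∀ d : D, ρ (ψ d) (w : M) - (w : M) ∈ r • ((ρ.restrict φI).toTopRep).ρ.invariants := by
  obtain ⟨c, rfl⟩ := oneCocycleClass_surjective _ x
  -- the restricted class is the class of `h ↦ c (φI h)`, and it dies in `H¹(I, M)`: a witness `m₂`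
  have hres : resH1 (torsionRep ρ r) φI (oneCocycleClass _ c) =
      oneCocycleClass _ (contOneCocycles.pullback φI (resMod (torsionRep ρ r) φI) c) :=
    map_oneCocycleClass _ _ _ c
  rw [hres] at hx
  change cohomologyMap (torsionIncl (ρ.restrict φI) r) 1
      (oneCocycleClass (torsionRep (ρ.restrict φI) r).toTopRep
        (contOneCocycles.pullback φI (resMod (torsionRep ρ r) φI) c)) = 0 at hx
  rw [cohomologyMap_oneCocycleClass, oneCocycleClass_eq_zero_iff] at hx
  obtain ⟨m₂, hm₂⟩ := hx
  have hm₂' : ∀ h : I, ((c.1 (φI h) : Submodule.torsionBy A M r) : M) = ρ (φI h) m₂ - m₂ := fun h => hm₂ h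
  -- the cocycle identity of `c`, read in `M`
  have hcoc : ∀ g k : Γ, ((c.1 (g * k) : Submodule.torsionBy A M r) : M) =
      ((c.1 g : Submodule.torsionBy A M r) : M) + ρ g ((c.1 k : Submodule.torsionBy A M r) : M) := fun g k => by
    have h2 := congrArg (fun z : Submodule.torsionBy A M r => (z : M)) (c.2 g k)
    change ((c.1 (g * k) : Submodule.torsionBy A M r) : M) =
      ((c.1 g + (torsionRep ρ r) g (c.1 k) : Submodule.torsionBy A M r) : M) at h2
    rw [h2, Submodule.coe_add, torsionRep_apply_coe]
  have hcr : ∀ g : Γ, r • ((c.1 g : Submodule.torsionBy A M r) : M) = 0 := fun g =>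
    (Submodule.mem_torsionBy_iff r _).1 (c.1 g).2
  -- `w := r • m₂` is `I`-invariant
  have hw : ∀ h : I, (ρ.restrict φI) h (r • m₂) = r • m₂ := fun h => by
    rw [ContinuousRep.restrict_apply, map_smul, show ρ (φI h) m₂ = m₂ + ((c.1 (φI h) : Submodule.torsionBy A M r) : M) by
      rw [hm₂' h]; abel, smul_add, hcr, add_zero]
  refine ⟨⟨r • m₂, fun h => hw h⟩, ?_, fun d => ?_⟩
  · -- `δ₀ (r • m₂) = [h ↦ c (φI h)]`: both are `h ↦ (φI h) m₂ − m₂` in `M`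
    rw [(isSES_torsion (ρ.restrict φI) r hr).δ₀_apply_eq ⟨r • m₂, fun h => hw h⟩ m₂ rfl, hres]
    change oneCocycleClass (torsionRep (ρ.restrict φI) r).toTopRep _ =
      oneCocycleClass (torsionRep (ρ.restrict φI) r).toTopRep
        (contOneCocycles.pullback φI (resMod (torsionRep ρ r) φI) c)
    refine congrArg _ (Subtype.ext (ContinuousMap.ext fun h => Subtype.ext ?_))
    have h1 := (isSES_torsion (ρ.restrict φI) r hr).f_δ₀Cocycle_apply m₂
      (by change r • m₂ ∈ _; exact fun h => hw h) h
    rw [torsionIncl_apply] at h1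
    rw [h1]
    change ((ρ.restrict φI) h) m₂ - m₂ = ((c.1 (φI h) : Submodule.torsionBy A M r) : M)
    rw [ContinuousRep.restrict_apply, hm₂' h]
  · -- `D`-invariance modulo `r`: `u = (ψ d) m₂ − m₂ − c (ψ d)` is `I`-fixed and `(ψ d) w − w = r • u`
    set u : M := ρ (ψ d) m₂ - m₂ - ((c.1 (ψ d) : Submodule.torsionBy A M r) : M) with hu_def
    have hu : ∀ h : I, (ρ.restrict φI) h u = u := by
      intro h
      obtain ⟨h₀, hh₀⟩ := hnormal d h
      have hrel : ψ d * φI h₀ = φI h * ψ d := by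
        rw [hfac h₀, hfac h, ← map_mul, ← map_mul, hh₀, ← mul_assoc, ← mul_assoc, mul_inv_cancel, one_mul]
      -- the cocycle identity at the two factorizations `ψ d · φI h₀ = φI h · ψ d` of the same element
      have hcomm : ρ (ψ d) (ρ (φI h₀) m₂) = ρ (φI h) (ρ (ψ d) m₂) := by
        rw [← Module.End.mul_apply, ← _root_.map_mul, hrel, _root_.map_mul, Module.End.mul_apply]
      have k1 := hcoc (ψ d) (φI h₀)
      rw [hrel, hcoc (φI h) (ψ d), hm₂' h₀, hm₂' h, map_sub, hcomm] at k1
      -- k1 : (ρ(φI h) m₂ − m₂) + ρ(φI h) c(ψ d) = c(ψ d) + (ρ(φI h) (ρ(ψ d) m₂) − ρ(ψ d) m₂)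
      rw [ContinuousRep.restrict_apply]
      have hz : ρ (φI h) u - u = 0 := by
        have e : ρ (φI h) (ρ (ψ d) m₂) =
            (((c.1 (ψ d) : Submodule.torsionBy A M r) : M) + (ρ (φI h) (ρ (ψ d) m₂) - ρ (ψ d) m₂)) +
              ρ (ψ d) m₂ - ((c.1 (ψ d) : Submodule.torsionBy A M r) : M) := by abel
        rw [← k1] at e
        rw [hu_def, map_sub, map_sub, e]
        abel
      exact sub_eq_zero.1 hz
    refine (Submodule.mem_smul_pointwise_iff_exists _ _ _).2 ⟨u, fun h => hu h, ?_⟩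
    rw [hu_def, smul_sub, smul_sub, hcr, sub_zero, ← map_smul]

end Local

/-! ## §2 The refined torsion-defect control: `hkill` only on `D_v`-invariant classes -/

section Control

variable {ι : Type*} {Γv : ι → Type u} [∀ v, Group (Γv v)] [∀ v, TopologicalSpace (Γv v)]
  [∀ v, IsTopologicalGroup (Γv v)] (φ : ∀ v, Γv v →ₜ* Γ) (L : Set ι)
  {Dv : ι → Type u} [∀ v, Group (Dv v)] [∀ v, TopologicalSpace (Dv v)]
  (ψ : ∀ v, Dv v →ₜ* Γ) (ιv : ∀ v, Γv v →ₜ* Dv v)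
  (ρ : ContinuousRep Γ A M) (r s : A)

/-- **Refined Lemma 3.4.1 (torsion defect, Selmer side): `hkill` is only needed on `D_v`-invariant classes.** As in
`TelescopeK2SelmerTorsionDefect.smul_mem_map_torsionInclH1_selmer` (p743708), for `r`-divisible `M` and an `r`-torsion Selmer class
`y`, `s • y ∈ H¹(ι)(Sel_L(M[r]))` — but the local hypothesis at each constrained index `v`, whose local map factors as
`φ v = ψ v ∘ ιv v` through a group `D_v` in which `ιv v (Γ_v)` is normal, is only required for the invariants `w ∈ (M|_v)^{Γ_v}` whose
class in `(M|_v)^{Γ_v} ⧸ r` is `D_v`-FIXED (`∀ d, ρ(ψ v d) w − w ∈ r • (M|_v)^{Γ_v}`). Indices without extra structure take the trivial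
factorization (`D_v = Γ_v`). [cite: JetchevSkinnerWan2017, §3.4, Lemma 3.4.1 (arXiv:1512.06894 p. 14)]
[cite: GreenbergVatsal2000, Prop. 2.4 (the local term through D_ℓ ⊇ I_ℓ)] [cite: Ochiai2006, Prop. 5.1 (Compositio 142 p. 1177)] -/
theorem smul_mem_map_torsionInclH1_selmer_of_factor (hr : Function.Surjective fun m : M => r • m)
    (hfac : ∀ (v : ι) (h : Γv v), φ v h = ψ v (ιv v h))
    (hnormal : ∀ (v : ι) (d : Dv v) (h : Γv v), ∃ h₀ : Γv v, ιv v h₀ = d⁻¹ * ιv v h * d)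
    (hkill : ∀ v ∈ L, ∀ w ∈ ((ρ.restrict (φ v)).toTopRep).ρ.invariants,
      (∀ d : Dv v, ρ (ψ v d) w - w ∈ r • ((ρ.restrict (φ v)).toTopRep).ρ.invariants) →
      ∃ w' ∈ ((ρ.restrict (φ v)).toTopRep).ρ.invariants, r • w' = s • w)
    {y : continuousCohomology 1 ρ.toTopRep} (hy : y ∈ selmer φ L ρ) (hyr : r • y = 0) :
    s • y ∈ Submodule.map (torsionInclH1 ρ r) (selmer φ L (torsionRep ρ r)) := by
  -- a lift of the `r`-torsion class to `H¹(Γ, M[r])`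
  obtain ⟨x, hx⟩ := exists_cohomologyMap_torsionIncl_eq ρ r hr y hyr
  -- `s • x` satisfies every constrained local condition
  have hd : ∀ v ∈ L, resH1 (torsionRep ρ r) (φ v) (s • x) = 0 := by
    intro v hv
    -- `res_v x` dies in `H¹(Γ_v, M)`
    have h0 : cohomologyMap (torsionIncl (ρ.restrict (φ v)) r) 1 (resH1 (torsionRep ρ r) (φ v) x) = 0 := by
      have h := resH1_cohomologyMap (φ v) (torsionIncl ρ r) x
      rw [hx] at h
      change (cohomologyMap (restrictHom (φ v) (torsionIncl ρ r)) 1) (resH1 (torsionRep ρ r) (φ v) x) = 0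
      rw [← h]
      exact (mem_selmer_iff φ L ρ _).1 hy v hv
    -- hence it is `δ₀,v` of an invariant `w` whose class mod `r` is `D_v`-fixed (§1)
    obtain ⟨w, hw, hwD⟩ := exists_invariant_δ₀_eq_of_factor ρ r (φ v) (ψ v) (ιv v) hr (hfac v) (hnormal v) x h0
    -- `s • w = r • w'` with `w'` invariant, so `δ₀,v (s • w) = 0`
    obtain ⟨w', hw', hw'eq⟩ := hkill v hv w.1 w.2 hwD
    have h1 : (isSES_torsion (ρ.restrict (φ v)) r hr).δ₀ (s • w) = 0 := by
      rw [(isSES_torsion (ρ.restrict (φ v)) r hr).δ₀_eq_zero_iff]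
      exact ⟨w', hw', hw'eq⟩
    rw [map_smul] at h1
    rw [map_smul, ← hw]
    exact h1
  have hmem : s • x ∈ selmer φ L (torsionRep ρ r) := (mem_selmer_iff φ L _ _).2 hd
  exact Submodule.mem_map.2 ⟨s • x, hmem, by rw [map_smul, torsionInclH1_apply, hx]⟩

/-- **`L₀`-form**: divisible local invariants off `L₀`, refined `hkill` on `L₀`. [cite: JetchevSkinnerWan2017, §3.4, Lemma 3.4.1] [folklore] -/
theorem smul_mem_map_torsionInclH1_selmer_of_factor_of_divisible_off (hr : Function.Surjective fun m : M => r • m)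
    (hfac : ∀ (v : ι) (h : Γv v), φ v h = ψ v (ιv v h))
    (hnormal : ∀ (v : ι) (d : Dv v) (h : Γv v), ∃ h₀ : Γv v, ιv v h₀ = d⁻¹ * ιv v h * d)
    (L₀ : Set ι)
    (hloc : ∀ v ∈ L, v ∉ L₀ → ∀ w ∈ ((ρ.restrict (φ v)).toTopRep).ρ.invariants,
      ∃ w' ∈ ((ρ.restrict (φ v)).toTopRep).ρ.invariants, r • w' = w)
    (hkill : ∀ v ∈ L, v ∈ L₀ → ∀ w ∈ ((ρ.restrict (φ v)).toTopRep).ρ.invariants,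
      (∀ d : Dv v, ρ (ψ v d) w - w ∈ r • ((ρ.restrict (φ v)).toTopRep).ρ.invariants) →
      ∃ w' ∈ ((ρ.restrict (φ v)).toTopRep).ρ.invariants, r • w' = s • w)
    {y : continuousCohomology 1 ρ.toTopRep} (hy : y ∈ selmer φ L ρ) (hyr : r • y = 0) :
    s • y ∈ Submodule.map (torsionInclH1 ρ r) (selmer φ L (torsionRep ρ r)) := by
  classical
  refine smul_mem_map_torsionInclH1_selmer_of_factor φ L ψ ιv ρ r s hr hfac hnormal (fun v hv w hw hwD => ?_) hy hyr
  by_cases hv₀ : v ∈ L₀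
  · exact hkill v hv hv₀ w hw hwD
  · obtain ⟨w', hw', hw'eq⟩ := hloc v hv hv₀ w hw
    exact ⟨s • w', Submodule.smul_mem _ _ hw', by rw [smul_comm, hw'eq]⟩

end Control

end Summit.BirchSwinnertonDyer.BirchSwinnertonDyer.Theorems.TelescopeK2RefinedLocalDefect

end
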